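import Summits.BirchSwinnertonDyer.BirchSwinnertonDyer.Theorems.SmallImageMuTransferMuTransferX9EulerSystemTameNorm
import Literature.NumberTheory.EllipticCurves.Kato2004.IwasawaH1ReductionPkSemilinear
import Literature.NumberTheory.EllipticCurves.IwasawaTwistModPk
import HarnessLib

set_option autoImplicit false

-- the summit and its single problem are both named `BirchSwinnertonDyer` (registry layout D-0017)
set_option linter.dupNamespace false

/-!
# Crux `KatoDivisibilityX9` (stmt-BirchSwinnertonDyer-20547), line `graded_euler_loss`, stub
# `stub_reciprocityPkAX9` (hG34ᵍ), item (M1) of the reduction `hKolyRecPk`, file 1: Kato's tame norm relation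
# `Cor z_{qp^m} = P_q(Fr_q⁻¹) z_{p^m}` at the layer `ℚ_n(μ_q)/ℚ_n`, REDUCED MODULO `p^k` — in
# `H¹(Gal(ℚ̄/ℚ_n), E[p^k])`, with the Euler factor acting through an INTEGER polynomial
# (`red_{p^k} ∘ P(Fr⁻¹·) = P̄(Fr⁻¹·) ∘ red_{p^k}`)

Seat `bsd-line-k6-p4` (prover-bsd-line-k6-p4-g5-0, wave-2 stub worker B).  THEOREMS ONLY (no definition, no
named fact, no `sorry`); nothing is asserted about any curve; `--supports stmt-BirchSwinnertonDyer-20547 --as helper`.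
This is the level-`p^k` twin of koly's `…X9EulerSystemTameNorm` §1–§2 (there: `reduceH1`, modulo `p`): the ONLY
change is the reduction map, `Kato2004.reduceH1Pk W p k U : H¹(U, T_pW) → H¹(U, W[p^k])` (tree
`Kato2004/IwasawaH1ReductionPk`, `x = p^k` in Kato §13.8), which is `ℤ_p`-SEMILINEAR through
`c ↦ (c mod p^k)` (`reduceH1Pk_smul`).

* §1 `pow_natCast_smul_H1_torsion_eq_zero` (`p^k · H¹(U, W[p^k]) = 0`), `reduceH1Pk_pow_frobeniusInvOp`,
  **`reduceH1Pk_aeval_frobeniusInvOp`**: for `P ∈ ℤ_p[X]` and any `P̄ ∈ ℤ[X]` with `P̄ ≡ P (mod p^k)`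
  coefficientwise, `red_{p^k} (P(Fr⁻¹·) y) = P̄(Fr⁻¹·) (red_{p^k} y)`; `reduceH1Pk_eulerFactorOp`.
* §2 **`coresLe_reduceH1Pk_coresLe_cons_eq_aeval`** — koly's `coresLe_coresLe_cons_eq_eulerFactorOp` (the
  Euler-system axiom `IsEulerSystem.cores_cons` pushed along the transfer, GENERIC over `T_pW`, reused verbatim)
  after `red_{p^k}`: `cor_{U→Γ} (red_{p^k} (cor_{→U} z_{m,{q}})) = P̄(Fr⁻¹·) (red_{p^k} (cor_{→Γ} z_{m,∅}))` in
  `H¹(Γ, W[p^k])`; and `reduceH1Pk_coresLe_cons_mem_integralH1` (Kato (8.1.3): the reduced tame class is integral).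

References: K. Rubin, *Euler Systems* (2000) Def. 2.1.1, Lemma 4.4.2; K. Kato, Astérisque 295 (2004) (8.1.3),
§13.1 (13.1.1), Ex. 13.3, §13.8 [Kato2004Asterisque]; B. Mazur, K. Rubin, Mem. AMS 799 (2004) §5.3 [MazurRubin2004].
-/

noncomputable section

open CategoryTheory Function Finset Polynomial
open scoped NumberField Pointwise
open Field IsDedekindDomain
open Literature.NumberTheory.GaloisRepresentations
open Literature.NumberTheory.EllipticCurves
open Literature.NumberTheory.EllipticCurves.ZpExtension
open Literature.NumberTheory.EllipticCurves.Kato2004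
open Literature.NumberTheory.EllipticCurves.Kato2004.EulerSystemValues
open Rat.HeightOneSpectrum
open Summit.BirchSwinnertonDyer.Rank1Residual.GaloisImage
open Summit.BirchSwinnertonDyer.Rank1Residual.GaloisImage.CyclotomicLevel.Rat
open Summit.BirchSwinnertonDyer.BirchSwinnertonDyer.Rank1Residual

namespace Summit.BirchSwinnertonDyer.BirchSwinnertonDyer.Theorems.OneSidedTwistSqueezeX9KatoDivisibilityX9KolyvaginReciprocityPkTameNorm

/-! ## §1 Reduction modulo `p^k` of scalars and of the Euler-factor operator -/

section Reduction

variable (W : WeierstrassCurve ℚ) [W.IsElliptic] (p : ℕ) [Fact p.Prime] (k : ℕ)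
  [ContinuousSMul ℤ_[p] (W.tateModule p)]

omit [W.IsElliptic] [Fact p.Prime] [ContinuousSMul ℤ_[p] (W.tateModule p)] in
/-- `H¹(U, W[p^k])` is killed by `p^k` (the coefficients are). [cite: Kato2004Asterisque, §13.8 (p. 228)] -/
theorem pow_natCast_smul_H1_torsion_eq_zero (U : Subgroup (absoluteGaloisGroup ℚ))
    (c : H1 (W.torsionGaloisModule ((p : ℤ) ^ k)) U) : ((p ^ k : ℕ) : ℤ) • c = 0 := by
  rw [natCast_zsmul]
  exact TameClass.nsmul_eq_zero_of_forall _ (fun x ↦ W.pow_nsmul_geomTorsion_eq_zero p k x) c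

/-- `red_{p^k} ∘ (Fr⁻¹·)^i = (Fr⁻¹·)^i ∘ red_{p^k}` (`reduceH1Pk_conjMap` iterated).
[cite: Kato2004Asterisque, §13.8 (p. 228)] -/
theorem reduceH1Pk_pow_frobeniusInvOp (U : Subgroup (absoluteGaloisGroup ℚ)) [U.Normal]
    (Fr : absoluteGaloisGroup ℚ) (i : ℕ) (y : H1 (tateRep W p) U) :
    reduceH1Pk W p k U ((frobeniusInvOp (tateRep W p) U Fr ^ i) y) =
      ((conjMap (W.torsionGaloisModule ((p : ℤ) ^ k)).toTopRep U Fr⁻¹ 1).hom.toLinearMap ^ i)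
        (reduceH1Pk W p k U y) := by
  induction i generalizing y with
  | zero => simp
  | succ i ih =>
    rw [pow_succ, pow_succ, Module.End.mul_apply, Module.End.mul_apply, ih]
    exact congrArg _ (reduceH1Pk_conjMap W p k U Fr⁻¹ y)

/-- **The Euler-factor operator survives reduction modulo `p^k` as an integer polynomial.**  For
`P ∈ ℤ_p[X]` and `P̄ ∈ ℤ[X]` with the same image in `(ℤ/p^k)[X]`:
`red_{p^k} (P(Fr⁻¹·) y) = P̄(Fr⁻¹·) (red_{p^k} y)` in `H¹(U, W[p^k])` (`red_{p^k}` is semilinear through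
`c ↦ c mod p^k`, and `H¹(U, W[p^k])` is killed by `p^k`, so the choice of `P̄` is immaterial).
[cite: Rubin2000, Def. 2.1.1] [cite: Kato2004Asterisque, §13.8 (p. 228)] -/
theorem reduceH1Pk_aeval_frobeniusInvOp (U : Subgroup (absoluteGaloisGroup ℚ)) [U.Normal]
    (Fr : absoluteGaloisGroup ℚ) (P : ℤ_[p][X]) (Pz : ℤ[X])
    (hP : Pz.map (Int.castRingHom (ZMod (p ^ k))) = P.map (PadicInt.toZModPow k))
    (y : H1 (tateRep W p) U) :
    reduceH1Pk W p k U (aeval (frobeniusInvOp (tateRep W p) U Fr) P y) =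
      aeval (conjMap (W.torsionGaloisModule ((p : ℤ) ^ k)).toTopRep U Fr⁻¹ 1).hom.toLinearMap Pz
        (reduceH1Pk W p k U y) := by
  -- a common bound on the degrees
  set n : ℕ := max P.natDegree Pz.natDegree + 1 with hn
  have hnP : P.natDegree < n := by omega
  have hnPz : Pz.natDegree < n := by omega
  rw [aeval_eq_sum_range' hnP, aeval_eq_sum_range' hnPz, LinearMap.sum_apply, LinearMap.sum_apply,
    map_sum]
  refine sum_congr rfl fun i _ ↦ ?_
  have hr : ∀ (m : ℤ) (f : Module.End ℤ (H1 (W.torsionGaloisModule ((p : ℤ) ^ k)) U))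
      (w : H1 (W.torsionGaloisModule ((p : ℤ) ^ k)) U), (m • f) w = m • f w := fun _ _ _ ↦ rfl
  rw [LinearMap.smul_apply, hr, reduceH1Pk_smul_nat, reduceH1Pk_pow_frobeniusInvOp]
  symm
  refine TameClass.zsmul_eq_nsmul_of_intCast_eq (n := p ^ k) ?_ ?_
  · rw [← natCast_zsmul]
    exact pow_natCast_smul_H1_torsion_eq_zero W p k U _
  · have h := congrArg (fun Q : (ZMod (p ^ k))[X] ↦ Q.coeff i) hP
    simp only [coeff_map, eq_intCast, ZMod.natCast_val] at h ⊢
    rw [h, ZMod.cast_id', id]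

variable [Module.Free ℤ_[p] (W.tateModule p)] [Module.Finite ℤ_[p] (W.tateModule p)]

/-- **The Euler factor `P(Fr_q⁻¹ | T_pW*; Fr_q⁻¹)` after reduction modulo `p^k`**: for any integer lift `P̄`
of Rubin's `rubinEulerFactor (tateRep W p) χ_cyc Fr` modulo `p^k`,
`red_{p^k} (eulerFactorOp T U p Fr y) = P̄(Fr⁻¹·) (red_{p^k} y)`. [cite: Rubin2000, Def. 2.1.1] -/
theorem reduceH1Pk_eulerFactorOp (U : Subgroup (absoluteGaloisGroup ℚ)) [U.Normal]
    (Fr : absoluteGaloisGroup ℚ) (Pz : ℤ[X])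
    (hP : Pz.map (Int.castRingHom (ZMod (p ^ k))) =
      (rubinEulerFactor (tateRep W p).toRepresentation (cyclotomicCharacterToUnits ℚ p ℤ_[p]) Fr).map
        (PadicInt.toZModPow k))
    (y : H1 (tateRep W p) U) :
    reduceH1Pk W p k U (eulerFactorOp (tateRep W p) U p Fr y) =
      aeval (conjMap (W.torsionGaloisModule ((p : ℤ) ^ k)).toTopRep U Fr⁻¹ 1).hom.toLinearMap Pz
        (reduceH1Pk W p k U y) :=
  reduceH1Pk_aeval_frobeniusInvOp W p k U Fr _ Pz hP y

end Reduction

/-! ## §2 The tame norm relation of an Euler system for `T_pW`, at a layer and modulo `p^k` -/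

section EulerSystem

variable (W : WeierstrassCurve ℚ) [W.IsElliptic] (p : ℕ) [Fact p.Prime] (k : ℕ)
  [ContinuousSMul ℤ_[p] (W.tateModule p)]
  [Module.Free ℤ_[p] (W.tateModule p)] [Module.Finite ℤ_[p] (W.tateModule p)]

variable {S : Set (HeightOneSpectrum (𝓞 ℚ))}
  {z : ∀ (m : ℕ) (r : (cyclotomicLevelsRat p S).Ideals),
    H1 (tateRep W p) ((cyclotomicLevelsRat p S).level m r.1)}

/-- **The tame norm relation modulo `p^k`**: with the data of koly's `coresLe_coresLe_cons_eq_eulerFactorOp`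
(an Euler system `z` for `T_pW`, a usable place `q ∉ S`, `ℓ ≠ 2`, a level `m`, an arithmetic Frobenius `Fr` at
`q`, normal open `Γ ≥ Gal(ℚ̄/ℚ(μ_{p^m}))`, `Γ ≥ U ≥ Gal(ℚ̄/ℚ(μ_{p^m}, μ_ℓ))`) and an integer lift `P̄` of the
Euler factor modulo `p^k`,
`cor_{U→Γ} (red_{p^k} (cor_{→U} z_{m,{q}})) = P̄(Fr⁻¹·) (red_{p^k} (cor_{→Γ} z_{m,∅}))` in `H¹(Γ, W[p^k])`.
[cite: Rubin2000, Lemma 4.4.2 (proof)] [cite: Kato2004Asterisque, §13.1 (13.1.1) and §13.8 (p. 228)] -/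
theorem coresLe_reduceH1Pk_coresLe_cons_eq_aeval
    (hz : IsEulerSystem (cyclotomicLevelsRat p S) (tateRep W p) p z) (m : ℕ)
    {q : HeightOneSpectrum (𝓞 ℚ)} (hq : q ∈ (cyclotomicLevelsRat p S).primes)
    (hq2 : ((primesEquiv q : Nat.Primes) : ℕ) ≠ 2)
    {Fr : absoluteGaloisGroup ℚ} (hFr : IsArithFrobAtPlace ℚ q Fr)
    (Pz : ℤ[X])
    (hP : Pz.map (Int.castRingHom (ZMod (p ^ k))) =
      (rubinEulerFactor (tateRep W p).toRepresentation (cyclotomicCharacterToUnits ℚ p ℤ_[p]) Fr).map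
        (PadicInt.toZModPow k))
    {Γ U : Subgroup (absoluteGaloisGroup ℚ)} [Γ.Normal] [U.Normal]
    (hUo : IsOpen (U : Set (absoluteGaloisGroup ℚ)))
    (h1 : (cyclotomicLevelsRat p S).level m ∅ ≤ Γ) (hUΓ : U ≤ Γ)
    (hVU : (cyclotomicLevelsRat p S).level m ((cyclotomicLevelsRat p S).idealOne.cons q hq).1 ≤ U)
    [Fintype (Γ ⧸ ((cyclotomicLevelsRat p S).level m ∅).subgroupOf Γ)]
    [Fintype (Γ ⧸ U.subgroupOf Γ)]
    [Fintype (U ⧸ ((cyclotomicLevelsRat p S).level m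
      ((cyclotomicLevelsRat p S).idealOne.cons q hq).1).subgroupOf U)] :
    coresLe (W.torsionGaloisModule ((p : ℤ) ^ k)).toTopRep hUΓ hUo
        (reduceH1Pk W p k U
          (coresLe (tateRep W p).toTopRep hVU ((cyclotomicLevelsRat p S).isOpen_level m _)
            (z m ((cyclotomicLevelsRat p S).idealOne.cons q hq)))) =
      aeval (conjMap (W.torsionGaloisModule ((p : ℤ) ^ k)).toTopRep Γ Fr⁻¹ 1).hom.toLinearMap Pz
        (reduceH1Pk W p k Γ
          (coresLe (tateRep W p).toTopRep h1 ((cyclotomicLevelsRat p S).isOpen_level m ∅)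
            (z m (cyclotomicLevelsRat p S).idealOne))) := by
  rw [← reduceH1Pk_coresLe,
    TameClass.coresLe_coresLe_cons_eq_eulerFactorOp W p hz m hq hq2 hFr hUo h1 hUΓ hVU,
    reduceH1Pk_eulerFactorOp W p k Γ Fr Pz hP]

omit [Module.Free ℤ_[p] (W.tateModule p)] [Module.Finite ℤ_[p] (W.tateModule p)] in
/-- **The reduced tame class at the layer `ℚ_n(μ_q)` is integral** (Kato (8.1.3) + `reduceH1Pk_mem_integralH1`):
`red_{p^k} (cor_{ℚ(μ_{p^m},μ_q) → N ∩ Γ} z_{m,{q}}) ∈ integralH1`, `N = Gal(ℚ̄/ℚ(μ_ℓ))`.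
[cite: Kato2004Asterisque, (8.1.3), §8.2 and Ex. 13.3] -/
theorem reduceH1Pk_coresLe_cons_mem_integralH1
    (hint : ∀ (m : ℕ) (r : (cyclotomicLevelsRat p S).Ideals),
      z m r ∈ integralH1 (tateRep W p) p ((cyclotomicLevelsRat p S).level m r.1))
    (m : ℕ) {q : HeightOneSpectrum (𝓞 ℚ)} (hq : q ∈ (cyclotomicLevelsRat p S).primes)
    {Γ : Subgroup (absoluteGaloisGroup ℚ)} [Γ.Normal]
    (hVU : (cyclotomicLevelsRat p S).level m ((cyclotomicLevelsRat p S).idealOne.cons q hq).1 ≤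
      rootsOfUnityFixer ℚ ((primesEquiv q : Nat.Primes) : ℕ) ⊓ Γ)
    [Fintype (↥(rootsOfUnityFixer ℚ ((primesEquiv q : Nat.Primes) : ℕ) ⊓ Γ) ⧸
      ((cyclotomicLevelsRat p S).level m ((cyclotomicLevelsRat p S).idealOne.cons q hq).1).subgroupOf
        (rootsOfUnityFixer ℚ ((primesEquiv q : Nat.Primes) : ℕ) ⊓ Γ))] :
    haveI : (rootsOfUnityFixer ℚ ((primesEquiv q : Nat.Primes) : ℕ)).Normal :=
      Subgroup.Normal.of_commutator_le _
        (haveI : NeZero ((primesEquiv q : Nat.Primes) : ℕ) := ⟨(primesEquiv q).2.ne_zero⟩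
         commutator_le_rootsOfUnityFixer ℚ _)
    reduceH1Pk W p k _ (coresLe (tateRep W p).toTopRep hVU ((cyclotomicLevelsRat p S).isOpen_level m _)
        (z m ((cyclotomicLevelsRat p S).idealOne.cons q hq))) ∈
      integralH1 (W.torsionGaloisModule ((p : ℤ) ^ k)) p
        (rootsOfUnityFixer ℚ ((primesEquiv q : Nat.Primes) : ℕ) ⊓ Γ) :=
  reduceH1Pk_mem_integralH1 W p k _ (TameClass.coresLe_cons_mem_integralH1 W p hint m hq hVU)

end EulerSystem

end Summit.BirchSwinnertonDyer.BirchSwinnertonDyer.Theorems.OneSidedTwistSqueezeX9KatoDivisibilityX9KolyvaginReciprocityPkTameNorm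

end
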